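import Summits.NavierStokesRegularity.NavierStokesRegularity.Theorems.AdaptedFrequencyAdaptedKernelExistsUpperOfMomentsBarrier
import Summits.NavierStokesRegularity.NavierStokesRegularity.Theorems.AdaptedFrequencyAdaptedKernelExistsUpperOfMomentsTight

/-!
# Crux `AdaptedKernelExists` (stmt-NavierStokesRegularity-2956), line `nash-entropy-last-block`:
  STUB `stub_upperOfMoments` (Gaussian upper bound on the last block from exponential moments)

Helper file (lands `--supports stmt-NavierStokesRegularity-2956`) proving the registered stub
`stub_upperOfMoments` of the line's skeleton: an adapted backward kernel `G` of `∂ₜ + b·∇ − νΔ`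
on `Ico t₀ T` (pole `(T, x₀)`) of a Type-I drift `‖b(t, x)‖ ≤ C/√(T − t)`, with some qualitative
Gaussian envelope and the exponential-moment bound
`∫ e^{⟨α, x − x₀⟩} G(t, x) dx ≤ exp(ν‖α‖²(T − t) + 2C‖α‖√(T − t))` at interior times, obeys the
Gaussian upper bound `G(t, x) ≤ C₁ (T−t)^{-3/2} e^{−‖x−x₀‖²/(C₂(T−t))}` at interior times, with
`C₁ = 6 (2πν)^{-3/2} e^{18C²/ν + 9/2}`, `C₂ = 32ν` depending on `(ν, C)` only (Carlen–Loss 1995,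
Duke 81, Thm 3 is the printed sharp statement; here ONE comparison from above on the last block
`[t, t + (T−t)/2]`).

## Proof

* the companion file `…UpperOfMomentsBarrier` gives the comparison from above
  (`upperOfMoments_comparison`): `G(t, x) ≤ ∫ G(t′, z) k₊(νh/2 + σ₀, x − z) dz + δ`
  (`h = T − t`, `t′ = t + h/2`, `k₊ = driftKernel 1 (C/(ν√(h/2)))`, any `δ > 0`, some
  `σ₀ ∈ (0, νh/2]`), given uniform spatial decay of `G` on the block, which
  `upperOfMoments_decay` extracts from the envelope;
* the companion file `…UpperOfMomentsTight` turns the moment bound at `t′` into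
  `∫ G(t′, z) k₊(σ, x − z) dz ≤ C₁ h^{-3/2} e^{−‖x−x₀‖²/(32νh)}` for `σ ∈ [νh/2, νh]`
  (`stub_upperOfMoments_convolution`);
* `stub_upperOfMoments`: combine and let `δ → 0`.
-/

noncomputable section

open MeasureTheory Set Filter Topology Metric Function Real
open Literature.Analysis.FluidPDE

namespace Summit.NavierStokesRegularity.NavierStokesRegularity.Theorems.AdaptedKernelExists.NashEntropyLastBlock

/-! ### The stub -/

/-- Spatial decay on an interior block from a qualitative Gaussian envelope: if
`G ≤ K (T−s)^{-3/2} e^{−‖y−x₀‖²/(a(T−s))}` on `Ioo t₀ T` (`a > 0`), then on every block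
`[t, t′] ⊆ (t₀, T)`, `G(s, y) ≤ δ` once `‖y − x₀‖ ≥ ρ₀(δ)` (`δ > 0`). -/
theorem upperOfMoments_decay {t₀ T t t' K a : ℝ} {x₀ : EuclideanSpace ℝ (Fin 3)}
    {G : ℝ → EuclideanSpace ℝ (Fin 3) → ℝ} (ht : t₀ < t) (htt' : t ≤ t') (ht'T : t' < T)
    (ha : 0 < a)
    (henv : ∀ s ∈ Ioo t₀ T, ∀ y, G s y ≤
      K * (T - s) ^ (-(3:ℝ) / 2) * Real.exp (-(‖y - x₀‖ ^ 2) / (a * (T - s))))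
    {δ : ℝ} (hδ : 0 < δ) :
    ∃ ρ₀ : ℝ, ∀ s ∈ Icc t t', ∀ y, ρ₀ ≤ ‖y - x₀‖ → G s y ≤ δ := by
  have hTt' : 0 < T - t' := sub_pos.2 ht'T
  have hlim : Tendsto (fun ρ : ℝ => |K| * (T - t') ^ (-(3:ℝ) / 2) *
      Real.exp (-ρ ^ 2 / (a * (T - t)))) atTop (𝓝 0) := by
    have h2 : Tendsto (fun ρ : ℝ => Real.exp (-ρ ^ 2 / (a * (T - t)))) atTop (𝓝 0) := by
      refine Real.tendsto_exp_atBot.comp ?_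
      exact (tendsto_neg_atTop_atBot.comp (tendsto_pow_atTop two_ne_zero)).atBot_div_const
        (by nlinarith)
    have := h2.const_mul (|K| * (T - t') ^ (-(3:ℝ) / 2))
    rw [mul_zero] at this
    exact this
  obtain ⟨ρ₀, hρ₀⟩ := eventually_atTop.1 (hlim.eventually (gt_mem_nhds hδ))
  refine ⟨ρ₀, fun s hs y hy => ?_⟩
  have hsI : s ∈ Ioo t₀ T := ⟨ht.trans_le hs.1, hs.2.trans_lt ht'T⟩
  have hTs : 0 < T - s := sub_pos.2 hsI.2
  have h1 : (T - s) ^ (-(3:ℝ) / 2) ≤ (T - t') ^ (-(3:ℝ) / 2) :=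
    Real.rpow_le_rpow_of_nonpos hTt' (by linarith [hs.2]) (by norm_num)
  have h2 : Real.exp (-(‖y - x₀‖ ^ 2) / (a * (T - s))) ≤
      Real.exp (-‖y - x₀‖ ^ 2 / (a * (T - t))) := by
    refine Real.exp_le_exp.2 ?_
    rw [neg_div, neg_div, neg_le_neg_iff]
    exact div_le_div_of_nonneg_left (sq_nonneg _) (by positivity)
      (mul_le_mul_of_nonneg_left (by linarith [hs.1]) ha.le)
  have h3 := hρ₀ ‖y - x₀‖ hy
  calc G s y ≤ K * (T - s) ^ (-(3:ℝ) / 2) * Real.exp (-(‖y - x₀‖ ^ 2) / (a * (T - s))) :=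
        henv s hsI y
    _ ≤ |K| * (T - s) ^ (-(3:ℝ) / 2) * Real.exp (-(‖y - x₀‖ ^ 2) / (a * (T - s))) := by
        gcongr; exact le_abs_self K
    _ ≤ |K| * (T - t') ^ (-(3:ℝ) / 2) * Real.exp (-‖y - x₀‖ ^ 2 / (a * (T - t))) := by
        gcongr
    _ ≤ δ := h3.le

/-- **Stub 2 of line `nash-entropy-last-block` — Gaussian upper bound on the last block from
exponential moments.** There are `C₁, C₂ > 0` depending only on `(ν, C)` (`C₂ = 32ν`,
`C₁ = 6 (2πν)^{-3/2} e^{18C²/ν + 9/2}`) such that every adapted backward kernel `G` on `Ico t₀ T`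
(pole `(T, x₀)`) of `∂ₜ + b·∇ − νΔ`, `b` a jointly smooth Type-I drift with constant `C`, which
has SOME qualitative Gaussian envelope and obeys the exponential-moment bound
`∫ e^{⟨α, x − x₀⟩} G(t) ≤ exp(ν‖α‖²(T−t) + 2C‖α‖√(T−t))` at interior times, satisfies
`G(t, x) ≤ C₁ (T−t)^{-3/2} exp(−‖x−x₀‖²/(C₂(T−t)))` for all `t ∈ Ioo t₀ T`. Proof: with
`h = T − t`, `t′ = t + h/2`, ONE comparison from above on the last block `[t, t′]` (drift bound
`C/√(h/2)`, `upperOfMoments_comparison`: the tree's `paraboloid_comparison` with the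
supersolution barrier `k₊ ⋆ (ψ G(t′))`, the envelope only making `G` small on the far side of a
large cylinder) gives `G(t, x) ≤ ∫ G(t′, z) k₊(νh/2 + σ₀, x − z) dz + δ` for every `δ > 0` with
some `σ₀ ∈ (0, νh/2]`, and the moment bound at `t′` turns the convolution into the Gaussian
(`stub_upperOfMoments_convolution`); then `δ → 0`. Uses positivity, `C²`, the adjoint equation at
interior times and integrability of the slices; not `div b = 0`. (Carlen–Loss 1995, Duke 81,
Thm 3 is the printed sharp form; `C₂ > 4ν` is forced by Galilean drifts.) -/
theorem stub_upperOfMoments :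
    ∀ (ν C : ℝ), 0 < ν → 0 ≤ C → ∃ C₁ C₂ : ℝ, 0 < C₁ ∧ 0 < C₂ ∧
      ∀ (t₀ T : ℝ) (b : ℝ → EuclideanSpace ℝ (Fin 3) → EuclideanSpace ℝ (Fin 3))
        (x₀ : EuclideanSpace ℝ (Fin 3)) (G : ℝ → EuclideanSpace ℝ (Fin 3) → ℝ),
        t₀ < T →
        IsSmoothSpaceTimeOn (Ico t₀ T) b →
        (∀ t ∈ Ico t₀ T, VectorCalculus.IsDivFree (b t)) →
        (∀ t ∈ Ico t₀ T, ∀ x, ‖b t x‖ ≤ C / Real.sqrt (T - t)) →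
        IsAdaptedBackwardKernel ν b (Ico t₀ T) T x₀ G →
        (∃ K a : ℝ, 0 < a ∧ ∀ t ∈ Ioo t₀ T, ∀ x,
          G t x ≤ K * (T - t) ^ (-(3:ℝ) / 2) * Real.exp (-(‖x - x₀‖ ^ 2) / (a * (T - t)))) →
        (∀ (α : EuclideanSpace ℝ (Fin 3)), ∀ t ∈ Ioo t₀ T,
          Integrable (fun x => Real.exp (inner ℝ α (x - x₀)) * G t x) ∧
          ∫ x, Real.exp (inner ℝ α (x - x₀)) * G t x ≤
            Real.exp (ν * ‖α‖ ^ 2 * (T - t) + 2 * C * ‖α‖ * Real.sqrt (T - t))) →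
        ∀ t ∈ Ioo t₀ T, ∀ x,
          G t x ≤ C₁ * (T - t) ^ (-(3:ℝ) / 2) * Real.exp (-(‖x - x₀‖ ^ 2) / (C₂ * (T - t))) := by
  intro ν C hν hC
  refine ⟨6 * (2 * Real.pi * ν) ^ (-(3:ℝ) / 2) * Real.exp (18 * C ^ 2 / ν + 9 / 2), 32 * ν,
    by positivity, by positivity, ?_⟩
  intro t₀ T b x₀ G _ hb _ hbd hG henv hmom t ht x
  obtain ⟨K, a, ha, henv⟩ := henv
  have hh : 0 < T - t := sub_pos.2 ht.2
  have hτ : 0 < (T - t) / 2 := half_pos hh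
  have htT : t + (T - t) / 2 < T := by linarith
  have ht' : t + (T - t) / 2 ∈ Ioo t₀ T := ⟨by linarith [ht.1], htT⟩
  have ht'S : t + (T - t) / 2 ∈ Ico t₀ T := Ioo_subset_Ico_self ht'
  have eT : T - (t + (T - t) / 2) = (T - t) / 2 := by ring
  -- the drift bound on the last block
  have hB : ∀ s ∈ Icc t (t + (T - t) / 2), ∀ y, ‖b s y‖ ≤ C / Real.sqrt ((T - t) / 2) := by
    intro s hs y
    have hsI : s ∈ Ico t₀ T := ⟨by linarith [ht.1, hs.1], by linarith [hs.2]⟩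
    refine (hbd s hsI y).trans ?_
    exact div_le_div_of_nonneg_left hC (Real.sqrt_pos.2 hτ)
      (Real.sqrt_le_sqrt (by linarith [hs.2]))
  -- decay on the block from the envelope
  have hdecay : ∀ δ : ℝ, 0 < δ → ∃ ρ₀ : ℝ, ∀ s ∈ Icc t (t + (T - t) / 2), ∀ y,
      ρ₀ ≤ ‖y - x₀‖ → G s y ≤ δ := fun δ hδ =>
    upperOfMoments_decay ht.1 (by linarith) htT ha henv hδ
  -- the moment bound at `t′`
  have hmom' : ∀ α : EuclideanSpace ℝ (Fin 3),
      Integrable (fun z => Real.exp (inner ℝ α (z - x₀)) * G (t + (T - t) / 2) z) ∧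
        ∫ z, Real.exp (inner ℝ α (z - x₀)) * G (t + (T - t) / 2) z ≤
          Real.exp (ν * ‖α‖ ^ 2 * ((T - t) / 2) + 2 * C * ‖α‖ * Real.sqrt ((T - t) / 2)) := by
    intro α
    have := hmom α _ ht'
    rwa [eT] at this
  -- comparison from above, convolution bound, `δ → 0`
  refine le_of_forall_pos_le_add fun δ hδ => ?_
  obtain ⟨σ₀, hσ₀, hσ₀τ, hcmp⟩ :=
    upperOfMoments_comparison hν ht.1 hτ htT hb hB (by positivity) hG hdecay x hδ
  have hconv := stub_upperOfMoments_convolution ν C (T - t) (ν * ((T - t) / 2) + σ₀) x₀ x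
    (G (t + (T - t) / 2)) hν hC hh (by linarith) (by linarith) (fun z => (hG.pos _ ht'S z).le)
    hmom'
  linarith

end Summit.NavierStokesRegularity.NavierStokesRegularity.Theorems.AdaptedKernelExists.NashEntropyLastBlock

end
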